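import Literature.MathematicalPhysics.StatisticalMechanics.Theil2006SimplexDeficitCount
import HarnessLib

/-!
# Theil 2006, Appendix pp. 23–24 — Lemma 2.7 (25), Proposition 2.8 (1), (2), (3), (70) and its
converse off the defects, from Proposition 4.8 (60)–(62), for centred simplices — proofs

Topic `Literature/MathematicalPhysics/StatisticalMechanics`; companion of `Theil2006.lean`
(F. Theil, *A proof of crystallization in two dimensions*, Comm. Math. Phys. **262** (2006),
accepted preprint of 26 Aug 2005, lit store `paper:url-69bff4ce1e30`), Appendix p. 23, *Proof of
Lemma 2.7*. PROVED; the conclusion of Proposition 4.8 (reference configuration with (60), (61))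
for the one pair of concentric balls used is the explicit hypothesis (D-0026: no named fact).

## Source, as printed (preprint p. 23)

"*Proof of Lemma 2.7.* Let `z = ⅓ Σ_{x∈T} y(x)`, `Ω = B(z, 20λ)` and `Ω′ = B(η, 3λ)` [sic: `z`].
Proposition 4.8 implies that there exists a discrete imbedding `Φ : y⁻¹(Ω′) → A₂` which
(1) coincides with `Φ_T` up to rotation and translation and (2) satisfies (61). This proves the
claim." ((25): `|λ⁻¹|y(x) − y(x′)| − 1| ≤ Kα` for `{x,x′} ⊂ T ∈ 𝒯_λ(y)`, p. 8; (60), (61), p. 21.)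

## What is proved

`Theil2006.preimage_closedBall_eq_ball`, `Theil2006.side_eq_dist_reference`: bookkeeping for
assembling the Proposition-4.8 hypotheses (closed vs open balls of particles; the side of a
centred simplex through a pair is read off a reference configuration around the midpoint).

`Theil2006.exists_centredSimplex_of_reference`: the (62)-construction of a centred simplex from a
lattice triangle of the reference configuration (pp. 24); `two_le_card_through_pair_of_reference`:
**Proposition 2.8 (2)** (hence (3)) from Proposition 4.8; `six_m_le_cornerCount_of_reference`:
**`s(x,λ) ≥ 6m(λ)` off the defects** (the "other direction" of p. 24) from Proposition 4.8, via
the lattice rotations `rot60` (tree) / `rot60inv`.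

`Theil2006.h70_of_reference`: **(70) itself** from (60) on `y⁻¹(B̄(y(x),2λ))` (`0 < α ≤ 1/200`):
`s(x,1) = 6` off the defects by `two_le_simplexCount` (Lemma 4.7) and `card_neighbours_eq_six`.

`Theil2006.cornerCount_le_six_m_of_reference`: (70)'s first half `s(x,λ) ≤ 6m(λ)` for centred
simplices from (60) on `y⁻¹(B̄(y(x), 2λ))` and (21) (`six_mul_m`), via the ordered-pair count
`card_shell_pairs_le` (each shell point has at most two partners at distance `λ`) (p. 24).

`Theil2006.card_through_pair_le_two_of_reference`: Proposition 2.8 (1)'s count `#𝒯(x₁,x₂) ≤ 2` at a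
fixed side `λ` for centred simplices, from (60) on `y⁻¹(B(m, 3λ/2+1))` and "(68) has at most
two solutions" (`no_three_equidistant`, two circles meet in at most two points) (p. 23).

`Theil2006.sideParameter_unique_of_reference`: Proposition 2.8 (1)'s uniqueness of the side
parameter of a centred long simplex from (60) on `y⁻¹(B(z, min(λ,λ′)+1))` (p. 23).

`Theil2006.lemma27_of_reference`: for a CENTRED simplex `T ∈ 𝒯_λ(y)` (`IsCentredSimplex`,
`Theil2006SimplexDeficitCount.lean` — the centring is exactly what makes "`T ⊂ y⁻¹(Ω′)`" true,
cf. the loophole of Definition 2.6 recorded there), `λ > 1`, under (13): IF on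
`ω = y⁻¹(B(z, λ+1))` there is a discrete imbedding `Φ` such that (60) every discrete imbedding
of `ω` is `Φ` followed by a rotation (on differences) and (61) `| |Φ(x)−Φ(x′)|/|y(x)−y(x′)| − 1| ≤ Kα`
on `ω`, and `Kα ≤ ½`, THEN `| |y(x)−y(x′)|/λ − 1 | ≤ 2Kα` for the pairs of `T`. Steps as printed:
`ω ⊂ ω_T` by (24) and (13) (injectivity of `y`), so `Φ_T|ω` is a discrete imbedding of `ω`;
(60) transports (23) `|Φ_T(x) − Φ_T(x′)| = λ` to `Φ`; (61) finishes.
-/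

noncomputable section

namespace Literature.MathematicalPhysics.StatisticalMechanics

namespace Theil2006

open Metric

variable {α : ℝ} {N : ℕ} {y : Fin N → Plane}

/-- `| λ/d − 1 | ≤ κ ≤ ½` implies `| d/λ − 1 | ≤ 2κ` (`d, λ > 0`). [folklore] -/
private theorem abs_div_sub_one_le_of_inv {d lam κ : ℝ} (hd : 0 < d) (hlam : 0 < lam) (hκ : κ ≤ 1 / 2)
    (h : |lam / d - 1| ≤ κ) : |d / lam - 1| ≤ 2 * κ := by
  have h1 := (abs_le.1 h).1
  have h2 := (abs_le.1 h).2
  have hκ0 : 0 ≤ κ := le_trans (abs_nonneg _) h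
  rw [div_sub_one (ne_of_gt hd)] at h1 h2
  rw [le_div_iff₀ hd] at h1
  rw [div_le_iff₀ hd] at h2
  rw [abs_le, div_sub_one (ne_of_gt hlam), le_div_iff₀ hlam, div_le_iff₀ hlam]
  constructor <;> nlinarith

/-- **Theil 2006, Lemma 2.7 (25) from Proposition 4.8 (60)+(61)** for a centred simplex, as on
p. 23: with `z` the barycentre of `y(T)` and `ω = y⁻¹(B(z, λ+1))`, a reference configuration `Φ`
on `ω` with (60) and (61) gives `| |y(x)−y(x′)|/λ − 1 | ≤ 2Kα` on the pairs of `T`.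
[cite: Theil2006, §2.3 Lemma 2.7 (25) with Appendix proof (p. 23) and Proposition 4.8 (60), (61) (preprint pp. 8, 21, 23)] -/
theorem lemma27_of_reference {K lam : ℝ} (hα : 0 < α) (hα1 : α < 1) (hKα : K * α ≤ 1 / 2)
    (hsep : ∀ i j : Fin N, i ≠ j → 1 - α < dist (y i) (y j))
    {T : Finset (Fin N)} (hT : IsCentredSimplex α y lam T) (hlam : 1 < lam)
    (h48 : ∃ Φ : Fin N → ℤ × ℤ,
      IsDiscreteImbeddingOn α y (y ⁻¹' ball (simplexCentre y T) (lam + 1)) Φ ∧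
      (∀ Φ' : Fin N → ℤ × ℤ,
        IsDiscreteImbeddingOn α y (y ⁻¹' ball (simplexCentre y T) (lam + 1)) Φ' →
        ∃ Rot : Plane ≃ₗᵢ[ℝ] Plane,
          ∀ x x' : Fin N, y x ∈ ball (simplexCentre y T) (lam + 1) →
            y x' ∈ ball (simplexCentre y T) (lam + 1) →
            triPoint (Φ' x) - triPoint (Φ' x') = Rot (triPoint (Φ x) - triPoint (Φ x'))) ∧
      (∀ x x' : Fin N, y x ∈ ball (simplexCentre y T) (lam + 1) →
        y x' ∈ ball (simplexCentre y T) (lam + 1) → x ≠ x' →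
        |dist (triPoint (Φ x)) (triPoint (Φ x')) / dist (y x) (y x') - 1| ≤ K * α)) :
    ∀ x ∈ T, ∀ x' ∈ T, x ≠ x' → |dist (y x) (y x') / lam - 1| ≤ 2 * (K * α) := by
  intro x hx x' hx' hxx'
  set z := simplexCentre y T with hz
  set ω : Set (Fin N) := y ⁻¹' ball z (lam + 1) with hω
  obtain ⟨Φ, hΦ, h60, h61⟩ := h48
  -- Definition 2.6, long-range branch
  obtain ⟨hT26, hcen⟩ := hT
  have hcen' := hcen hlam
  rcases hT26.2 with h1 | ⟨-, -, ωT, ΦT, -, hTω, hΦT, h23, -, h24⟩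
  · exact absurd h1.1 (ne_of_gt hlam)
  -- `ω ⊂ ω_T` by (24) and the injectivity of `y` under (13)
  have hyinj : Function.Injective y := by
    intro i j hij
    by_contra hne
    have := hsep i j hne
    rw [hij, dist_self] at this
    linarith
  have hωT : ω ⊆ ωT := by
    intro a ha
    have ha' : y a ∈ closedBall z (3 * lam) ∩ Set.range y := by
      refine ⟨?_, Set.mem_range_self a⟩
      rw [mem_closedBall]
      have := mem_ball.1 ha
      linarith
    obtain ⟨a', ha'ω, hya⟩ := h24 ha'
    rwa [← hyinj hya]
  -- T ⊂ ω (centring)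
  have hTω' : ∀ a ∈ T, a ∈ ω := fun a ha => by
    show y a ∈ ball z (lam + 1)
    rw [mem_ball]
    linarith [hcen' a ha]
  -- (60): Φ_T|ω = Rot ∘ Φ on differences
  obtain ⟨Rot, hRot⟩ := h60 ΦT (hΦT.mono hωT)
  have hdistΦ : dist (triPoint (Φ x)) (triPoint (Φ x')) = lam := by
    have h := hRot x x' (hTω' x hx) (hTω' x' hx')
    have h23' := h23 x hx x' hx' hxx'
    rw [dist_eq_norm] at h23' ⊢
    rw [h, LinearIsometryEquiv.norm_map] at h23'
    exact h23'
  -- (61)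
  have h61' := h61 x x' (hTω' x hx) (hTω' x' hx') hxx'
  rw [hdistΦ] at h61'
  have hd : 0 < dist (y x) (y x') := by
    have := hsep x x' hxx'; linarith
  exact abs_div_sub_one_le_of_inv hd (by linarith) hKα h61'


/-- **Theil 2006, Proposition 2.8 (1), uniqueness of the side parameter, from Proposition 4.8
(60)** (p. 23: "`Φ(x′) − Φ(x₁) = Q₁(Φ₁(x′) − Φ₁(x₁)) = Q₂(Φ₂(x′) − Φ₂(x₁))` … The choice `x′ = x₂`
establishes that `λ₁ = λ₂`"): if a centred `T` lies in `𝒯_λ(y)` and in `𝒯_{λ′}(y)` (`λ, λ′ > 1`)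
and `ω = y⁻¹(B(z, min(λ,λ′) + 1))` carries a reference configuration with (60), then `λ = λ′`.
[cite: Theil2006, §2.3 Proposition 2.8 (1) with Appendix proof (p. 23) and Proposition 4.8 (60) (preprint pp. 8, 21, 23)] -/
theorem sideParameter_unique_of_reference {lam lam' : ℝ} (hα : 0 < α) (hα1 : α < 1)
    (hsep : ∀ i j : Fin N, i ≠ j → 1 - α < dist (y i) (y j))
    {T : Finset (Fin N)} (hT : IsCentredSimplex α y lam T) (hT' : IsCentredSimplex α y lam' T)
    (hlam : 1 < lam) (hlam' : 1 < lam')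
    (h48 : ∃ Φ : Fin N → ℤ × ℤ,
      IsDiscreteImbeddingOn α y (y ⁻¹' ball (simplexCentre y T) (min lam lam' + 1)) Φ ∧
      (∀ Φ' : Fin N → ℤ × ℤ,
        IsDiscreteImbeddingOn α y (y ⁻¹' ball (simplexCentre y T) (min lam lam' + 1)) Φ' →
        ∃ Rot : Plane ≃ₗᵢ[ℝ] Plane,
          ∀ x x' : Fin N, y x ∈ ball (simplexCentre y T) (min lam lam' + 1) →
            y x' ∈ ball (simplexCentre y T) (min lam lam' + 1) →
            triPoint (Φ' x) - triPoint (Φ' x') = Rot (triPoint (Φ x) - triPoint (Φ x')))) :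
    lam = lam' := by
  set z := simplexCentre y T with hz
  set ω : Set (Fin N) := y ⁻¹' ball z (min lam lam' + 1) with hω
  obtain ⟨Φ, hΦ, h60⟩ := h48
  obtain ⟨hT26, hcen⟩ := hT
  obtain ⟨hT26', hcen2⟩ := hT'
  have hyinj : Function.Injective y := by
    intro i j hij
    by_contra hne
    have := hsep i j hne
    rw [hij, dist_self] at this
    linarith
  -- two vertices of T
  obtain ⟨a, b, c, hab, -, -, rfl⟩ := Finset.card_eq_three.1 hT26.1
  have ha : a ∈ ({a, b, c} : Finset (Fin N)) := by simp
  have hb : b ∈ ({a, b, c} : Finset (Fin N)) := by simp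
  have haω : a ∈ ω := by
    show y a ∈ ball z (min lam lam' + 1); rw [mem_ball]
    have h1 := hcen hlam a ha; have h2 := hcen2 hlam' a ha
    have : dist (y a) z ≤ min lam lam' := le_min h1 h2
    linarith
  have hbω : b ∈ ω := by
    show y b ∈ ball z (min lam lam' + 1); rw [mem_ball]
    have h1 := hcen hlam b hb; have h2 := hcen2 hlam' b hb
    have : dist (y b) z ≤ min lam lam' := le_min h1 h2
    linarith
  -- the two imbeddings restricted to ω
  have key : ∀ {μ : ℝ}, 1 < μ → min lam lam' ≤ μ →
      IsEquilateralSimplex α y μ {a, b, c} →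
      dist (triPoint (Φ a)) (triPoint (Φ b)) = μ := by
    intro μ hμ hμle hE
    rcases hE.2 with h1 | ⟨-, -, ωT, ΦT, -, hTω, hΦT, h23, -, h24⟩
    · exact absurd h1.1 (ne_of_gt hμ)
    have hωT : ω ⊆ ωT := by
      intro q hq
      have hq' : y q ∈ closedBall z (3 * μ) ∩ Set.range y := by
        refine ⟨?_, Set.mem_range_self q⟩
        rw [mem_closedBall]
        have := mem_ball.1 hq
        linarith
      obtain ⟨q', hq'ω, hyq⟩ := h24 hq'
      rwa [← hyinj hyq]
    obtain ⟨Rot, hRot⟩ := h60 ΦT (hΦT.mono hωT)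
    have h := hRot a b haω hbω
    have h23' := h23 a ha b hb hab
    rw [dist_eq_norm] at h23' ⊢
    rw [h, LinearIsometryEquiv.norm_map] at h23'
    exact h23'
  have e1 := key hlam (min_le_left lam lam') hT26
  have e2 := key hlam' (min_le_right lam lam') hT26'
  rw [← e1, ← e2]


/-! ### (68) has at most two solutions: two circles meet in at most two points -/

/-- Coordinates algebra: three pairwise distinct points on the circle `|a| = λ` and on the line
`2 a·d = |d|²` (`d ≠ 0`) do not exist. [folklore] -/
private theorem no_three_on_circle_and_line {a10 a11 a20 a21 a30 a31 d0 d1 L : ℝ}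
    (hd : d0 ≠ 0 ∨ d1 ≠ 0)
    (C1 : a10 ^ 2 + a11 ^ 2 = L) (C2 : a20 ^ 2 + a21 ^ 2 = L) (C3 : a30 ^ 2 + a31 ^ 2 = L)
    (L1 : 2 * (a10 * d0 + a11 * d1) = d0 ^ 2 + d1 ^ 2)
    (L2 : 2 * (a20 * d0 + a21 * d1) = d0 ^ 2 + d1 ^ 2)
    (L3 : 2 * (a30 * d0 + a31 * d1) = d0 ^ 2 + d1 ^ 2)
    (h12 : a10 ≠ a20 ∨ a11 ≠ a21) (h13 : a10 ≠ a30 ∨ a11 ≠ a31)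
    (h23 : a20 ≠ a30 ∨ a21 ≠ a31) : False := by
  -- det(d, a_i + a_j) = 0 for each pair (the chord is orthogonal to d and to a_i + a_j)
  have det_of : ∀ {b10 b11 b20 b21 : ℝ}, b10 ^ 2 + b11 ^ 2 = L → b20 ^ 2 + b21 ^ 2 = L →
      2 * (b10 * d0 + b11 * d1) = d0 ^ 2 + d1 ^ 2 → 2 * (b20 * d0 + b21 * d1) = d0 ^ 2 + d1 ^ 2 →
      (b10 ≠ b20 ∨ b11 ≠ b21) → d0 * (b11 + b21) - d1 * (b10 + b20) = 0 := by
    intro b10 b11 b20 b21 hC1 hC2 hL1 hL2 hne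
    have ud : (b10 - b20) * d0 + (b11 - b21) * d1 = 0 := by linarith
    have us : (b10 - b20) * (b10 + b20) + (b11 - b21) * (b11 + b21) = 0 := by
      linear_combination hC1 - hC2
    rcases hne with h | h
    · have : (b10 - b20) * (d0 * (b11 + b21) - d1 * (b10 + b20)) = 0 := by
        linear_combination (b11 + b21) * ud - d1 * us
      exact (mul_eq_zero.1 this).resolve_left (sub_ne_zero.2 h)
    · have : (b11 - b21) * (d0 * (b11 + b21) - d1 * (b10 + b20)) = 0 := by
        linear_combination d0 * us - (b10 + b20) * ud
      exact (mul_eq_zero.1 this).resolve_left (sub_ne_zero.2 h)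
  have d12 := det_of C1 C2 L1 L2 h12
  have d13 := det_of C1 C3 L1 L3 h13
  have d23 := det_of C2 C3 L2 L3 h23
  -- hence det(d, a1 - a2) = 0, and (a1 - a2) ⊥ d: so a1 = a2
  have det : d0 * (a11 - a21) - d1 * (a10 - a20) = 0 := by linarith
  have ud : (a10 - a20) * d0 + (a11 - a21) * d1 = 0 := by linarith
  have key : ((a10 - a20) ^ 2 + (a11 - a21) ^ 2) * (d0 ^ 2 + d1 ^ 2) = 0 := by
    linear_combination ((a10 - a20) * d0 + (a11 - a21) * d1) * ud +
      (d0 * (a11 - a21) - d1 * (a10 - a20)) * det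
  have hd2 : 0 < d0 ^ 2 + d1 ^ 2 := by
    rcases hd with h | h
    · have := pow_pos (abs_pos.2 h) 2
      rw [sq_abs] at this; positivity
    · have := pow_pos (abs_pos.2 h) 2
      rw [sq_abs] at this; positivity
  have hu : (a10 - a20) ^ 2 + (a11 - a21) ^ 2 = 0 := by
    rcases mul_eq_zero.1 key with h | h
    · exact h
    · exact absurd h (ne_of_gt hd2)
  have h1 : a10 - a20 = 0 := by nlinarith [sq_nonneg (a10 - a20), sq_nonneg (a11 - a21)]
  have h2 : a11 - a21 = 0 := by nlinarith [sq_nonneg (a10 - a20), sq_nonneg (a11 - a21)]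
  rcases h12 with h | h
  · exact h (by linarith)
  · exact h (by linarith)

/-- Squared distance in coordinates on `ℝ²`. [folklore] -/
private theorem dist_sq_eq_coord (u v : Plane) : dist u v ^ 2 = (u 0 - v 0) ^ 2 + (u 1 - v 1) ^ 2 := by
  rw [EuclideanSpace.dist_eq, Fin.sum_univ_two, Real.dist_eq, Real.dist_eq,
    Real.sq_sqrt (by positivity), sq_abs, sq_abs]

/-- **"In two dimensions (68) has at most two solutions"** (p. 23): three pairwise distinct
points at distance `λ` from both `p` and `q ≠ p` do not exist. [folklore] -/
private theorem no_three_equidistant {p q η₁ η₂ η₃ : Plane} (hpq : p ≠ q) {lam : ℝ}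
    (h1p : dist η₁ p = lam) (h1q : dist η₁ q = lam) (h2p : dist η₂ p = lam)
    (h2q : dist η₂ q = lam) (h3p : dist η₃ p = lam) (h3q : dist η₃ q = lam)
    (h12 : η₁ ≠ η₂) (h13 : η₁ ≠ η₃) (h23 : η₂ ≠ η₃) : False := by
  have ne_coord : ∀ {u v : Plane}, u ≠ v → u 0 - p 0 ≠ v 0 - p 0 ∨ u 1 - p 1 ≠ v 1 - p 1 := by
    intro u v huv
    by_contra h
    push Not at h
    apply huv
    ext i
    fin_cases i
    · simpa using h.1
    · simpa using h.2
  have hd : q 0 - p 0 ≠ 0 ∨ q 1 - p 1 ≠ 0 := by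
    rcases ne_coord (Ne.symm hpq) with h | h
    · left; simpa using h
    · right; simpa using h
  have cp : ∀ {η : Plane}, dist η p = lam → (η 0 - p 0) ^ 2 + (η 1 - p 1) ^ 2 = lam ^ 2 :=
    fun h => by rw [← h, dist_sq_eq_coord]
  have cq : ∀ {η : Plane}, dist η p = lam → dist η q = lam →
      2 * ((η 0 - p 0) * (q 0 - p 0) + (η 1 - p 1) * (q 1 - p 1)) =
        (q 0 - p 0) ^ 2 + (q 1 - p 1) ^ 2 := by
    intro η hp hq
    have e1 := cp hp
    have e2 : (η 0 - q 0) ^ 2 + (η 1 - q 1) ^ 2 = lam ^ 2 := by rw [← hq, dist_sq_eq_coord]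
    nlinarith [e1, e2]
  exact no_three_on_circle_and_line hd (cp h1p) (cp h2p) (cp h3p) (cq h1p h1q) (cq h2p h2q)
    (cq h3p h3q) (ne_coord h12) (ne_coord h13) (ne_coord h23)


/-! ### Proposition 2.8 (1), the count: at most two simplices through a pair -/

/-- **Theil 2006, Proposition 2.8 (1) (`#𝒯(x₁,x₂) ≤ 2` at a fixed side `λ`) from Proposition 4.8
(60)** as on p. 23: all centred `T ∈ 𝒯_λ(y)` through `{x₁,x₂}` lie in `B(m, 3λ/2 + 1)`, `m` the
midpoint; a reference configuration `Φ` there turns each third vertex `x₃` into a lattice point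
`η = Φ(x₃)` with (68) `|η − Φ(x₁)| = |η − Φ(x₂)| = λ` (by (60) and (23)); "in two dimensions (68)
has at most two solutions", and `Φ` is injective. (With `sideParameter_unique_of_reference` this
is Proposition 2.8 (1) for centred simplices.)
[cite: Theil2006, §2.3 Proposition 2.8 (1) with Appendix proof (68) (p. 23) and Proposition 4.8 (60) (preprint pp. 8, 21, 23)] -/
theorem card_through_pair_le_two_of_reference {lam : ℝ} (hα : 0 < α) (hα1 : α < 1)
    (hsep : ∀ i j : Fin N, i ≠ j → 1 - α < dist (y i) (y j)) {x₁ x₂ : Fin N} (hx : x₁ ≠ x₂)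
    (hlam : 1 < lam)
    (h48 : ∃ Φ : Fin N → ℤ × ℤ,
      IsDiscreteImbeddingOn α y (y ⁻¹' ball ((2 : ℝ)⁻¹ • (y x₁ + y x₂)) (3 / 2 * lam + 1)) Φ ∧
      (∀ Φ' : Fin N → ℤ × ℤ,
        IsDiscreteImbeddingOn α y (y ⁻¹' ball ((2 : ℝ)⁻¹ • (y x₁ + y x₂)) (3 / 2 * lam + 1)) Φ' →
        ∃ Rot : Plane ≃ₗᵢ[ℝ] Plane,
          ∀ x x' : Fin N, y x ∈ ball ((2 : ℝ)⁻¹ • (y x₁ + y x₂)) (3 / 2 * lam + 1) →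
            y x' ∈ ball ((2 : ℝ)⁻¹ • (y x₁ + y x₂)) (3 / 2 * lam + 1) →
            triPoint (Φ' x) - triPoint (Φ' x') = Rot (triPoint (Φ x) - triPoint (Φ x')))) :
    ((simplicesAt α y lam).filter fun T => x₁ ∈ T ∧ x₂ ∈ T).card ≤ 2 := by
  classical
  set m : Plane := (2 : ℝ)⁻¹ • (y x₁ + y x₂) with hm
  set ω : Set (Fin N) := y ⁻¹' ball m (3 / 2 * lam + 1) with hω
  obtain ⟨Φ, hΦ, h60⟩ := h48
  have hyinj : Function.Injective y := by
    intro i j hij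
    by_contra hne
    have := hsep i j hne
    rw [hij, dist_self] at this
    linarith
  -- the data of one simplex through the pair
  have key : ∀ T ∈ (simplicesAt α y lam).filter (fun T => x₁ ∈ T ∧ x₂ ∈ T),
      ∃ z : Fin N, z ∈ ω ∧ ({x₁, x₂, z} : Finset (Fin N)) = T ∧
        dist (triPoint (Φ z)) (triPoint (Φ x₁)) = lam ∧
        dist (triPoint (Φ z)) (triPoint (Φ x₂)) = lam ∧
        dist (triPoint (Φ x₁)) (triPoint (Φ x₂)) = lam := by
    intro T hT
    obtain ⟨hTs, hx1, hx2⟩ := Finset.mem_filter.1 hT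
    obtain ⟨hT26, hcen⟩ := mem_simplicesAt.1 hTs
    have hcen' := hcen hlam
    -- the third vertex
    have hcard3 := hT26.1
    have hcard1 : ((T.erase x₁).erase x₂).card = 1 := by
      rw [Finset.card_erase_of_mem (Finset.mem_erase.2 ⟨hx.symm, hx2⟩),
        Finset.card_erase_of_mem hx1, hcard3]
    obtain ⟨z, hz⟩ := Finset.card_eq_one.1 hcard1
    have hzmem : z ∈ (T.erase x₁).erase x₂ := by rw [hz]; exact Finset.mem_singleton_self z
    have hz2 : z ≠ x₂ := (Finset.mem_erase.1 hzmem).1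
    have hz1 : z ≠ x₁ := (Finset.mem_erase.1 (Finset.mem_erase.1 hzmem).2).1
    have hzT : z ∈ T := (Finset.mem_erase.1 (Finset.mem_erase.1 hzmem).2).2
    have hTeq : ({x₁, x₂, z} : Finset (Fin N)) = T := by
      refine Finset.eq_of_subset_of_card_le (fun a ha => ?_) ?_
      · simp only [Finset.mem_insert, Finset.mem_singleton] at ha
        rcases ha with rfl | rfl | rfl
        · exact hx1
        · exact hx2
        · exact hzT
      · rw [hcard3, Finset.card_insert_of_notMem (by simp [hx, hz1.symm]),
          Finset.card_insert_of_notMem (by simp [hz2.symm]), Finset.card_singleton]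
    -- barycentre vs midpoint: c - m = ½ (y z - c)
    have hc : simplexCentre y T = (3 : ℝ)⁻¹ • (y x₁ + (y x₂ + y z)) := by
      rw [simplexCentre, ← hTeq, Finset.sum_insert (by simp [hx, hz1.symm]),
        Finset.sum_insert (by simp [hz2.symm]), Finset.sum_singleton]
    have hcm : dist (simplexCentre y T) m ≤ lam / 2 := by
      have e : simplexCentre y T - m = (2 : ℝ)⁻¹ • (y z - simplexCentre y T) := by
        rw [hc, hm]; module
      rw [dist_eq_norm, e, norm_smul, Real.norm_eq_abs, abs_of_pos (by norm_num), ← dist_eq_norm]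
      have := hcen' z hzT
      linarith
    -- T ⊂ ω
    have hTω : ∀ a ∈ T, a ∈ ω := by
      intro a ha
      show y a ∈ ball m (3 / 2 * lam + 1)
      rw [mem_ball]
      have h1 := hcen' a ha
      have := dist_triangle (y a) (simplexCentre y T) m
      linarith
    -- ω ⊂ ω_T, (60), (23)
    rcases hT26.2 with h1 | ⟨-, -, ωT, ΦT, -, hTωT, hΦT, h23, -, h24⟩
    · exact absurd h1.1 (ne_of_gt hlam)
    have hωT : ω ⊆ ωT := by
      intro q hq
      have hq' : y q ∈ closedBall (simplexCentre y T) (3 * lam) ∩ Set.range y := by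
        refine ⟨?_, Set.mem_range_self q⟩
        rw [mem_closedBall]
        have h1 := mem_ball.1 hq
        have := dist_triangle (y q) m (simplexCentre y T)
        rw [dist_comm m] at this
        linarith
      obtain ⟨q', hq'ω, hyq⟩ := h24 hq'
      rwa [← hyinj hyq]
    obtain ⟨Rot, hRot⟩ := h60 ΦT (hΦT.mono hωT)
    have transport : ∀ a ∈ T, ∀ b ∈ T, a ≠ b →
        dist (triPoint (Φ a)) (triPoint (Φ b)) = lam := by
      intro a ha b hb hab
      have h := hRot a b (hTω a ha) (hTω b hb)
      have h23' := h23 a ha b hb hab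
      rw [dist_eq_norm] at h23' ⊢
      rw [h, LinearIsometryEquiv.norm_map] at h23'
      exact h23'
    exact ⟨z, hTω z hzT, hTeq, transport z hzT x₁ hx1 hz1, transport z hzT x₂ hx2 hz2,
      transport x₁ hx1 x₂ hx2 hx⟩
  -- three distinct simplices would give three solutions of (68)
  by_contra hgt
  rw [not_le] at hgt
  obtain ⟨T₁, hT₁, T₂, hT₂, T₃, hT₃, h12, h13, h23⟩ := Finset.two_lt_card.1 hgt
  obtain ⟨z₁, hz₁ω, hz₁T, hz₁p, hz₁q, hpq⟩ := key T₁ hT₁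
  obtain ⟨z₂, hz₂ω, hz₂T, hz₂p, hz₂q, -⟩ := key T₂ hT₂
  obtain ⟨z₃, hz₃ω, hz₃T, hz₃p, hz₃q, -⟩ := key T₃ hT₃
  have hne : ∀ {z z' : Fin N} {T T' : Finset (Fin N)}, z ∈ ω → z' ∈ ω →
      ({x₁, x₂, z} : Finset (Fin N)) = T → ({x₁, x₂, z'} : Finset (Fin N)) = T' → T ≠ T' →
      triPoint (Φ z) ≠ triPoint (Φ z') := by
    intro z z' T T' hz hz' hT hT' hTT' heq
    apply hTT'
    have hzz : z = z' := hΦ.injOn hz hz' (triPoint_injective heq)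
    rw [← hT, ← hT', hzz]
  have hpq' : triPoint (Φ x₁) ≠ triPoint (Φ x₂) := by
    intro h
    rw [h, dist_self] at hpq
    linarith
  exact no_three_equidistant hpq' hz₁p hz₁q hz₂p hz₂q hz₃p hz₃q (hne hz₁ω hz₂ω hz₁T hz₂T h12)
    (hne hz₁ω hz₃ω hz₁T hz₃T h13) (hne hz₂ω hz₃ω hz₂T hz₃T h23)


/-! ### (70), first half: `s(x, λ) ≤ 6 m(λ)` from (60) -/

/-- On the distance shell `{η ∈ A₂ : |η| = λ}` every point has at most two partners at distance
`λ` (two circles meet in at most two points). [folklore] -/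
private theorem card_shell_partners_le_two {lam : ℝ} {u : ℤ × ℤ} (hu : u ∈ shell lam) :
    (((shell_finite lam).toFinset.filter fun v => ‖triPoint (u - v)‖ = lam).card : ℕ) ≤ 2 := by
  classical
  by_contra hgt
  rw [not_le] at hgt
  obtain ⟨v₁, hv₁, v₂, hv₂, v₃, hv₃, h12, h13, h23⟩ := Finset.two_lt_card.1 hgt
  have data : ∀ {v : ℤ × ℤ}, v ∈ (shell_finite lam).toFinset.filter (fun v => ‖triPoint (u - v)‖ = lam) →
      dist (triPoint v) 0 = lam ∧ dist (triPoint v) (triPoint u) = lam := by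
    intro v hv
    obtain ⟨hvS, hvu⟩ := Finset.mem_filter.1 hv
    have hv' := (Set.Finite.mem_toFinset _).1 hvS
    refine ⟨by rw [dist_zero_right]; exact hv'.2, ?_⟩
    rw [dist_comm, dist_eq_norm, ← map_sub]; exact hvu
  have hu0 : (0 : Plane) ≠ triPoint u := by
    intro h
    have := hu.2
    rw [← h, norm_zero] at this
    have h1 := hu.1
    apply h1
    apply triPoint_injective
    rw [map_zero]; exact h.symm
  have hne : ∀ {v v' : ℤ × ℤ}, v ≠ v' → triPoint v ≠ triPoint v' :=
    fun h heq => h (triPoint_injective heq)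
  exact no_three_equidistant hu0 (data hv₁).1 (data hv₁).2 (data hv₂).1 (data hv₂).2
    (data hv₃).1 (data hv₃).2 (hne h12) (hne h13) (hne h23)

/-- The ordered pairs `(u, v)` of shell points at distance `λ` number at most `2 · 6m(λ)`.
[cite: Theil2006, §2.3 (21) (preprint p. 8); our count] -/
theorem card_shell_pairs_le {lam : ℝ} :
    ((((shell_finite lam).toFinset ×ˢ (shell_finite lam).toFinset).filter
        fun uv => ‖triPoint (uv.1 - uv.2)‖ = lam).card : ℕ) ≤ 2 * (6 * m lam) := by
  classical
  set S := (shell_finite lam).toFinset with hS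
  set Q := (S ×ˢ S).filter fun uv => ‖triPoint (uv.1 - uv.2)‖ = lam with hQ
  have hSc : S.card = 6 * m lam := by
    rw [six_mul_m, Nat.card_coe_set_eq, Set.ncard_eq_toFinset_card _ (shell_finite lam)]
  have h1 : Q.card ≤ 2 * (Q.image Prod.fst).card := by
    refine Finset.card_le_mul_card_image _ 2 fun u hu => ?_
    obtain ⟨⟨u', v⟩, huv, rfl⟩ := Finset.mem_image.1 hu
    have huS : u' ∈ S := (Finset.mem_product.1 (Finset.mem_filter.1 huv).1).1
    have hu' : u' ∈ shell lam := (Set.Finite.mem_toFinset _).1 huS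
    refine le_trans (Finset.card_le_card_of_injOn Prod.snd (fun w hw => ?_) ?_)
      (card_shell_partners_le_two hu')
    · obtain ⟨hwQ, hwu⟩ := Finset.mem_filter.1 hw
      obtain ⟨hwS, hwd⟩ := Finset.mem_filter.1 hwQ
      simp only at hwu
      refine Finset.mem_filter.2 ⟨(Finset.mem_product.1 hwS).2, ?_⟩
      rw [← hwu]; exact hwd
    · intro w hw w' hw' h
      have hwu := (Finset.mem_filter.1 (Finset.mem_coe.1 hw)).2
      have hwu' := (Finset.mem_filter.1 (Finset.mem_coe.1 hw')).2
      simp only at hwu hwu' h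
      exact Prod.ext (hwu.trans hwu'.symm) h
  have h2 : (Q.image Prod.fst).card ≤ S.card :=
    Finset.card_le_card fun u hu => by
      obtain ⟨⟨u', v⟩, huv, rfl⟩ := Finset.mem_image.1 hu
      exact (Finset.mem_product.1 (Finset.mem_filter.1 huv).1).1
  calc Q.card ≤ 2 * (Q.image Prod.fst).card := h1
    _ ≤ 2 * S.card := Nat.mul_le_mul_left 2 h2
    _ = 2 * (6 * m lam) := by rw [hSc]


/-- A two-element finset is `{min, max}`. [folklore] -/
private theorem pair_eq_min_max {s : Finset (Fin N)} (hs : s.card = 2) (h : s.Nonempty) :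
    ({s.min' h, s.max' h} : Finset (Fin N)) = s := by
  have hne : s.min' h ≠ s.max' h :=
    ne_of_lt (Finset.min'_lt_max'_of_card s (by rw [hs]; norm_num))
  refine Finset.eq_of_subset_of_card_le (fun a ha => ?_) ?_
  · simp only [Finset.mem_insert, Finset.mem_singleton] at ha
    rcases ha with rfl | rfl
    · exact Finset.min'_mem _ _
    · exact Finset.max'_mem _ _
  · rw [hs, Finset.card_pair hne]

/-- **Theil 2006, (70) first half: `s(x, λ) ≤ 6 m(λ)` from Proposition 4.8 (60)** (p. 24: "by
uniqueness of `Φ` we can find a rotation matrix `R ∈ SO(2)` such that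
`Φ_{T′}(x₁) − Φ_{T′}(x₂) = R(Φ(x₁) − Φ(x₂))`. This implies that `|Φ(x₁) − Φ(x₂)| = λ`. The number
of pairs `{η₁, η₂} ⊂ A₂` which satisfies the equations `|η₁ − Φ(x)| = |η₂ − Φ(x)| = |η₁ − η₂|` can
be expressed as `#({|η − Φ(x)| = λ} ∩ A₂)`, together with formula (21) this implies that
`s(x,λ) ≤ 6m(λ)`"). For centred simplices, with the reference configuration on
`ω = y⁻¹(B̄(y(x), 2λ))`: the two other vertices of a `T ∈ 𝒯_λ(y)` with corner `x` give an
ordered pair of shell vectors `Φ(a) − Φ(x)`, `Φ(b) − Φ(x)` at distance `λ`; both orders are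
injective in `T` with disjoint images, and such pairs number `≤ 2 · 6m(λ)` (each shell point has
at most two partners).
[cite: Theil2006, Appendix proof of Proposition 2.9 (70) with (21) and Proposition 4.8 (60) (preprint pp. 8, 21, 24)] -/
theorem cornerCount_le_six_m_of_reference {lam : ℝ} (hα1 : α < 1)
    (hsep : ∀ i j : Fin N, i ≠ j → 1 - α < dist (y i) (y j)) (x : Fin N) (hlam : 1 < lam)
    (h48 : ∃ Φ : Fin N → ℤ × ℤ,
      IsDiscreteImbeddingOn α y (y ⁻¹' closedBall (y x) (2 * lam)) Φ ∧
      (∀ Φ' : Fin N → ℤ × ℤ, IsDiscreteImbeddingOn α y (y ⁻¹' closedBall (y x) (2 * lam)) Φ' →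
        ∃ Rot : Plane ≃ₗᵢ[ℝ] Plane,
          ∀ a b : Fin N, y a ∈ closedBall (y x) (2 * lam) → y b ∈ closedBall (y x) (2 * lam) →
            triPoint (Φ' a) - triPoint (Φ' b) = Rot (triPoint (Φ a) - triPoint (Φ b)))) :
    cornerCount α y lam x ≤ 6 * m lam := by
  classical
  set ω : Set (Fin N) := y ⁻¹' closedBall (y x) (2 * lam) with hω
  obtain ⟨Φ, hΦ, h60⟩ := h48
  have hyinj : Function.Injective y := by
    intro i j hij
    by_contra hne
    have := hsep i j hne
    rw [hij, dist_self] at this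
    linarith
  unfold cornerCount
  set 𝒯x := (simplicesAt α y lam).filter fun T => x ∈ T with h𝒯x
  -- per-simplex data
  have key : ∀ T ∈ 𝒯x, x ∈ T ∧ (T.erase x).card = 2 ∧ (∀ a ∈ T, a ∈ ω) ∧
      (∀ a ∈ T.erase x, Φ a - Φ x ∈ shell lam) ∧
      (∀ a ∈ T.erase x, ∀ b ∈ T.erase x, a ≠ b →
        ‖triPoint ((Φ a - Φ x) - (Φ b - Φ x))‖ = lam) := by
    intro T hT
    obtain ⟨hTs, hxT⟩ := Finset.mem_filter.1 hT
    obtain ⟨hT26, hcen⟩ := mem_simplicesAt.1 hTs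
    have hcen' := hcen hlam
    have hE : (T.erase x).card = 2 := by rw [Finset.card_erase_of_mem hxT, hT26.1]
    have hTω : ∀ a ∈ T, a ∈ ω := fun a ha => by
      show y a ∈ closedBall (y x) (2 * lam)
      rw [mem_closedBall]
      have h1 := hcen' a ha
      have h2 := hcen' x hxT
      have := dist_triangle (y a) (simplexCentre y T) (y x)
      rw [dist_comm (simplexCentre y T) (y x)] at this
      linarith
    rcases hT26.2 with h1 | ⟨-, -, ωT, ΦT, -, hTωT, hΦT, h23, -, h24⟩
    · exact absurd h1.1 (ne_of_gt hlam)
    have hωT : ω ⊆ ωT := by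
      intro q hq
      have hq' : y q ∈ closedBall (simplexCentre y T) (3 * lam) ∩ Set.range y := by
        refine ⟨?_, Set.mem_range_self q⟩
        rw [mem_closedBall]
        have h1 := mem_closedBall.1 hq
        have h2 := hcen' x hxT
        have := dist_triangle (y q) (y x) (simplexCentre y T)
        linarith
      obtain ⟨q', hq'ω, hyq⟩ := h24 hq'
      rwa [← hyinj hyq]
    obtain ⟨Rot, hRot⟩ := h60 ΦT (hΦT.mono hωT)
    have transport : ∀ a ∈ T, ∀ b ∈ T, a ≠ b → ‖triPoint (Φ a - Φ b)‖ = lam := by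
      intro a ha b hb hab
      have h := hRot a b (hTω a ha) (hTω b hb)
      have h23' := h23 a ha b hb hab
      rw [dist_eq_norm] at h23'
      rw [h, LinearIsometryEquiv.norm_map, ← map_sub] at h23'
      exact h23'
    refine ⟨hxT, hE, hTω, fun a ha => ?_, fun a ha b hb hab => ?_⟩
    · have hax := Finset.mem_erase.1 ha
      refine ⟨fun h0 => hax.1 ?_, ?_⟩
      · exact hΦ.injOn (hTω a hax.2) (hTω x hxT) (sub_eq_zero.1 h0)
      · exact transport a hax.2 x hxT hax.1
    · have hax := Finset.mem_erase.1 ha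
      have hbx := Finset.mem_erase.1 hb
      rw [sub_sub_sub_cancel_right]
      exact transport a hax.2 b hbx.2 hab
  -- the pair map
  set S := (shell_finite lam).toFinset with hS
  set Q := (S ×ˢ S).filter fun uv => ‖triPoint (uv.1 - uv.2)‖ = lam with hQ
  let G : Finset (Fin N) → (ℤ × ℤ) × (ℤ × ℤ) := fun T =>
    if h : (T.erase x).Nonempty then
      (Φ ((T.erase x).min' h) - Φ x, Φ ((T.erase x).max' h) - Φ x) else 0
  have hGdata : ∀ T ∈ 𝒯x, ∃ h : (T.erase x).Nonempty,
      (T.erase x).min' h < (T.erase x).max' h ∧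
      G T = (Φ ((T.erase x).min' h) - Φ x, Φ ((T.erase x).max' h) - Φ x) := by
    intro T hT
    have hE := (key T hT).2.1
    have hne : (T.erase x).Nonempty := by rw [← Finset.card_pos, hE]; norm_num
    exact ⟨hne, Finset.min'_lt_max'_of_card _ (by rw [hE]; norm_num), by simp only [G, dif_pos hne]⟩
  have hmemQ : ∀ T ∈ 𝒯x, ∀ a ∈ T.erase x, ∀ b ∈ T.erase x, a ≠ b → (Φ a - Φ x, Φ b - Φ x) ∈ Q := by
    intro T hT a ha b hb hab
    obtain ⟨-, -, -, hshell, hdist⟩ := key T hT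
    refine Finset.mem_filter.2 ⟨Finset.mem_product.2 ⟨?_, ?_⟩, hdist a ha b hb hab⟩
    · exact (Set.Finite.mem_toFinset _).2 (hshell a ha)
    · exact (Set.Finite.mem_toFinset _).2 (hshell b hb)
  have hG1 : ∀ T ∈ 𝒯x, G T ∈ Q := by
    intro T hT
    obtain ⟨h, hlt, hG⟩ := hGdata T hT
    rw [hG]
    exact hmemQ T hT _ (Finset.min'_mem _ _) _ (Finset.max'_mem _ _) (ne_of_lt hlt)
  have hG2 : ∀ T ∈ 𝒯x, (G T).swap ∈ Q := by
    intro T hT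
    obtain ⟨h, hlt, hG⟩ := hGdata T hT
    rw [hG, Prod.swap_prod_mk]
    exact hmemQ T hT _ (Finset.max'_mem _ _) _ (Finset.min'_mem _ _) (ne_of_gt hlt)
  -- Φ-differences determine the vertex
  have hvert : ∀ T ∈ 𝒯x, ∀ T' ∈ 𝒯x, ∀ a ∈ T.erase x, ∀ a' ∈ T'.erase x,
      Φ a - Φ x = Φ a' - Φ x → a = a' := by
    intro T hT T' hT' a ha a' ha' h
    have hTω := (key T hT).2.2.1
    have hTω' := (key T' hT').2.2.1
    exact hΦ.injOn (hTω a (Finset.mem_of_mem_erase ha)) (hTω' a' (Finset.mem_of_mem_erase ha'))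
      (sub_left_inj.1 h)
  have hinj : Set.InjOn G ↑𝒯x := by
    intro T hT T' hT' hGG
    have hT := Finset.mem_coe.1 hT
    have hT' := Finset.mem_coe.1 hT'
    obtain ⟨h, hlt, hG⟩ := hGdata T hT
    obtain ⟨h', hlt', hG'⟩ := hGdata T' hT'
    rw [hG, hG'] at hGG
    obtain ⟨e1, e2⟩ := Prod.mk.inj hGG
    have emin := hvert T hT T' hT' _ (Finset.min'_mem _ _) _ (Finset.min'_mem _ _) e1
    have emax := hvert T hT T' hT' _ (Finset.max'_mem _ _) _ (Finset.max'_mem _ _) e2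
    have hEq : T.erase x = T'.erase x := by
      rw [← pair_eq_min_max (key T hT).2.1 h, ← pair_eq_min_max (key T' hT').2.1 h', emin, emax]
    rw [← Finset.insert_erase (key T hT).1, hEq, Finset.insert_erase (key T' hT').1]
  have hinj2 : Set.InjOn (fun T => (G T).swap) ↑𝒯x := by
    intro T hT T' hT' h
    exact hinj hT hT' (Prod.swap_injective h)
  have hdisj : Disjoint (𝒯x.image G) (𝒯x.image fun T => (G T).swap) := by
    rw [Finset.disjoint_left]
    intro uv h1 h2
    obtain ⟨T, hT, rfl⟩ := Finset.mem_image.1 h1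
    obtain ⟨T', hT', hEq⟩ := Finset.mem_image.1 h2
    obtain ⟨h, hlt, hG⟩ := hGdata T hT
    obtain ⟨h', hlt', hG'⟩ := hGdata T' hT'
    rw [hG, hG', Prod.swap_prod_mk] at hEq
    obtain ⟨e1, e2⟩ := Prod.mk.inj hEq
    have e1' := hvert T' hT' T hT _ (Finset.max'_mem _ _) _ (Finset.min'_mem _ _) e1
    have e2' := hvert T' hT' T hT _ (Finset.min'_mem _ _) _ (Finset.max'_mem _ _) e2
    rw [← e1', ← e2'] at hlt
    exact absurd (hlt.trans hlt') (lt_irrefl _)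
  have hsub : 𝒯x.image G ∪ 𝒯x.image (fun T => (G T).swap) ⊆ Q := by
    intro uv huv
    rcases Finset.mem_union.1 huv with h | h
    · obtain ⟨T, hT, rfl⟩ := Finset.mem_image.1 h; exact hG1 T hT
    · obtain ⟨T, hT, rfl⟩ := Finset.mem_image.1 h; exact hG2 T hT
  have hcount : 2 * 𝒯x.card ≤ Q.card := by
    have h := Finset.card_le_card hsub
    rw [Finset.card_union_of_disjoint hdisj, Finset.card_image_of_injOn hinj,
      Finset.card_image_of_injOn hinj2] at h
    omega
  have hQ2 : Q.card ≤ 2 * (6 * m lam) := by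
    rw [hQ, hS]; exact card_shell_pairs_le
  omega


/-! ### (70), second half: `s(x, 1) = 6` off the defects, and (70) itself -/

/-- A non-defect has exactly six neighbours (finset form of `ncard_neighbours_eq_six`).
[cite: Theil2006, §2.1 (preprint p. 4)] -/
theorem card_neighbours_eq_six (hα1 : α < 1) {x : Fin N} (hx : x ∉ defectSet α y) :
    (neighbours α y x).card = 6 := by
  rw [← ncard_neighbours_eq_six hα1 hx, ← Set.ncard_coe_finset]
  congr 1
  ext a
  rw [Finset.mem_coe, mem_neighbours_iff, Set.mem_setOf_eq]

/-- **Double counting at a corner**: `2 s(x,1) = Σ_{x' ∈ 𝒩(x)∖{x}} #{T ∈ 𝒯₁ | {x,x'} ⊂ T}`.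
[cite: Theil2006, Appendix proof of Proposition 2.9 (69)–(70) (preprint p. 24); our bookkeeping] -/
theorem two_mul_cornerCount_one (hα1 : α < 1) (x : Fin N) :
    2 * cornerCount α y 1 x = ∑ a ∈ neighbours α y x, simplexCount α y x a := by
  classical
  unfold cornerCount
  set A := (simplicesAt α y 1).filter fun T => x ∈ T with hA
  have hAmem : ∀ T ∈ A, IsEquilateralSimplex α y 1 T ∧ x ∈ T := fun T hT => by
    have h := Finset.mem_filter.1 hT
    exact ⟨(mem_simplicesAt.1 h.1).1, h.2⟩
  have hl : ∑ T ∈ A, (T.erase x).card = 2 * A.card := by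
    rw [mul_comm, Finset.sum_const_nat (m := 2) fun T hT => ?_]
    obtain ⟨hT, hxT⟩ := hAmem T hT
    rw [Finset.card_erase_of_mem hxT, hT.card_eq_three]
  have hshort : ∀ T ∈ A, ∀ a ∈ T.erase x, a ∈ neighbours α y x := by
    intro T hTA a haT
    rw [mem_neighbours_iff]
    obtain ⟨hT1, hxT⟩ := hAmem T hTA
    have hax := Finset.mem_erase.1 haT
    exact (isEquilateralSimplex_one_iff.1 hT1).2 x hxT a hax.2 (Ne.symm hax.1)
  have h2 : 2 * A.card = ∑ a : Fin N, (A.filter fun T => a ∈ T.erase x).card := by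
    rw [← hl]
    have e1 : ∀ T : Finset (Fin N),
        (T.erase x).card = ∑ a : Fin N, if a ∈ T.erase x then 1 else 0 := by
      intro T
      rw [Finset.sum_ite_mem, Finset.univ_inter, Finset.card_eq_sum_ones]
    simp_rw [Finset.card_filter, e1]
    exact Finset.sum_comm
  have h3 : ∀ a, (A.filter fun T => a ∈ T.erase x).card =
      if a ∈ neighbours α y x then simplexCount α y x a else 0 := by
    intro a
    split_ifs with ha
    · have hax : a ≠ x := ((mem_neighbours_iff).1 ha).ne hα1 |>.symm
      unfold simplexCount
      congr 1
      ext T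
      rw [Finset.mem_filter, Finset.mem_filter, Finset.mem_erase, Finset.mem_filter,
        ← unitSimplices_eq_simplicesAt]
      constructor
      · rintro ⟨⟨hT, hxT⟩, -, haT⟩; exact ⟨hT, hxT, haT⟩
      · rintro ⟨hT, hxT, haT⟩; exact ⟨⟨hT, hxT⟩, hax, haT⟩
    · rw [Finset.card_eq_zero, Finset.filter_eq_empty_iff]
      exact fun T hTA haT => ha (hshort T hTA a haT)
  rw [h2, Finset.sum_congr rfl fun a _ => h3 a, Finset.sum_ite_mem, Finset.univ_inter]

/-- **`s(x, 1) ≥ 6` off the defects** (so `= 6` with `cornerCount_one_le_six`): every short bond at a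
particle of `X ∖ 𝒩(∂X)` lies in two unit simplices (Lemma 4.7, `two_le_simplexCount`) and a
non-defect has six neighbours. [cite: Theil2006, Appendix proof of Proposition 2.9 ("we obtain that s(x,1) = 6", preprint p. 24) with Lemma 4.7] -/
theorem six_le_cornerCount_one (hα : 0 < α) (hα' : α ≤ 1 / 200)
    (hsep : ∀ i j : Fin N, i ≠ j → 1 - α < dist (y i) (y j)) {x : Fin N}
    (hx : x ∉ defectSet α y) (hN : ∀ ⦃b⦄, IsShortRange α y x b → b ∉ defectSet α y) :
    6 ≤ cornerCount α y 1 x := by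
  have hα1 : α < 1 := by linarith
  have h2 := two_mul_cornerCount_one (y := y) hα1 x
  have h6 := card_neighbours_eq_six (y := y) hα1 hx
  have hsum : ∑ a ∈ neighbours α y x, 2 ≤ ∑ a ∈ neighbours α y x, simplexCount α y x a :=
    Finset.sum_le_sum fun a ha => two_le_simplexCount hα hα' hsep hx hN ((mem_neighbours_iff).1 ha)
  rw [Finset.sum_const, smul_eq_mul, h6] at hsum
  omega

/-- **Theil 2006, (70) `s(x, λ) ≤ m(λ) s(x, 1)` from Proposition 4.8 (60)** (centred simplices,
`λ > 1`, `0 < α ≤ 1/200`, (13)): if `s(x,λ) ≠ 0` then `x` is far from the defects (Definition 2.6),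
so `s(x,1) = 6`, and `s(x,λ) ≤ 6m(λ)` by `cornerCount_le_six_m_of_reference`.
[cite: Theil2006, Appendix proof of Proposition 2.9 (70) with Proposition 4.8 (60) (preprint pp. 21, 24)] -/
theorem h70_of_reference {lam : ℝ} (hα : 0 < α) (hα' : α ≤ 1 / 200)
    (hsep : ∀ i j : Fin N, i ≠ j → 1 - α < dist (y i) (y j)) (x : Fin N) (hlam : 1 < lam)
    (h48 : ∃ Φ : Fin N → ℤ × ℤ,
      IsDiscreteImbeddingOn α y (y ⁻¹' closedBall (y x) (2 * lam)) Φ ∧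
      (∀ Φ' : Fin N → ℤ × ℤ, IsDiscreteImbeddingOn α y (y ⁻¹' closedBall (y x) (2 * lam)) Φ' →
        ∃ Rot : Plane ≃ₗᵢ[ℝ] Plane,
          ∀ a b : Fin N, y a ∈ closedBall (y x) (2 * lam) → y b ∈ closedBall (y x) (2 * lam) →
            triPoint (Φ' a) - triPoint (Φ' b) = Rot (triPoint (Φ a) - triPoint (Φ b)))) :
    cornerCount α y lam x ≤ m lam * cornerCount α y 1 x := by
  classical
  have hα1 : α < 1 := by linarith
  by_cases h0 : cornerCount α y lam x = 0
  · rw [h0]; exact Nat.zero_le _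
  -- a centred simplex with corner x: x is far from the defects
  obtain ⟨T, hT⟩ := Finset.card_pos.1 (Nat.pos_of_ne_zero h0)
  obtain ⟨hTs, hxT⟩ := Finset.mem_filter.1 hT
  obtain ⟨hT26, hcen⟩ := mem_simplicesAt.1 hTs
  have hcx := hcen hlam x hxT
  rcases hT26.2 with h1 | ⟨-, hfar, -⟩
  · exact absurd h1.1 (ne_of_gt hlam)
  have far : ∀ b ∈ defectSet α y, 19 * lam < dist (y b) (y x) := by
    intro b hb
    have h := hfar b hb
    have := dist_triangle (y b) (y x) (simplexCentre y T)
    linarith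
  have hx : x ∉ defectSet α y := by
    intro hxd
    have := far x hxd
    rw [dist_self] at this
    linarith
  have hN : ∀ ⦃b⦄, IsShortRange α y x b → b ∉ defectSet α y := by
    intro b hb hbd
    have h1 := far b hbd
    have h2 := hb.dist_le
    rw [dist_comm] at h2
    linarith
  have h6 := six_le_cornerCount_one hα hα' hsep hx hN
  have hle := cornerCount_le_six_m_of_reference hα1 hsep x hlam h48
  calc cornerCount α y lam x ≤ 6 * m lam := hle
    _ ≤ m lam * cornerCount α y 1 x := by rw [mul_comm]; exact Nat.mul_le_mul_left _ h6


/-! ### Constructing centred simplices from a reference configuration ((62)) -/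

/-- (61) with lattice distance `λ` bounds the particle distance: `|y(v) − y(w)| ≤ λ/(1 − Kα)`,
hence `≤ 3λ/2` for `Kα ≤ 1/3`. [folklore] -/
private theorem dist_le_of_ratio {d lam κ : ℝ} (hd : 0 < d) (hκ : κ ≤ 1 / 3)
    (h : |lam / d - 1| ≤ κ) : d ≤ 3 / 2 * lam := by
  have h1 := (abs_le.1 h).1
  rw [div_sub_one (ne_of_gt hd), le_div_iff₀ hd] at h1
  nlinarith

/-- **The simplex spanned by a lattice triangle of the reference configuration** (the construction
of Proposition 2.8 (2), p. 24, and of the proof of (70), p. 24): let `Φ` be a reference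
configuration on `ω = y⁻¹(B(y(a), r))`, `r > 4λ`, with (61) (constant `K`, `Kα ≤ 1/3`) and the
surjectivity (62) at `a` for lattice points within `3λ/2` of `Φ(a)`, and let no defect lie within
`21λ` of `y(a)`. Then for lattice points `η₁, η₂` with `|η_i − Φ(a)| = |η₁ − η₂| = λ` (`λ > 1`)
their preimages `x₁, x₂` form with `a` a CENTRED simplex `{a, x₁, x₂} ∈ 𝒯_λ(y)`: patch
`ω_T = y⁻¹(B̄(z, 3λ))`, `Φ_T = Φ`, (23) by construction, (24) and the defect clause by the radii,
the centring by (61) ("Estimate (61) implies that `|⅓Σ_{x∈T±} y(x) − y(x₁)| ≤ λ`", p. 24).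
[cite: Theil2006, Appendix proof of Proposition 2.8 (2) and of (70), Proposition 4.8 (61), (62), Definition 2.6 (preprint pp. 8, 21, 24)] -/
theorem exists_centredSimplex_of_reference {K lam r : ℝ} (hα : 0 < α) (hα1 : α < 1)
    (hKα : K * α ≤ 1 / 3) (hsep : ∀ i j : Fin N, i ≠ j → 1 - α < dist (y i) (y j))
    (a : Fin N) (hlam : 1 < lam) (hr : 4 * lam < r) {Φ : Fin N → ℤ × ℤ}
    (hΦ : IsDiscreteImbeddingOn α y (y ⁻¹' ball (y a) r) Φ)
    (h61 : ∀ v w : Fin N, y v ∈ ball (y a) r → y w ∈ ball (y a) r → v ≠ w →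
      |dist (triPoint (Φ v)) (triPoint (Φ w)) / dist (y v) (y w) - 1| ≤ K * α)
    (h62 : ∀ g : ℤ × ℤ, dist (triPoint g) (triPoint (Φ a)) < 3 / 2 * lam →
      ∃ v : Fin N, y v ∈ ball (y a) r ∧ Φ v = g)
    (hfar : ∀ b ∈ defectSet α y, 21 * lam < dist (y b) (y a))
    {η₁ η₂ : ℤ × ℤ} (h₁ : dist (triPoint η₁) (triPoint (Φ a)) = lam)
    (h₂ : dist (triPoint η₂) (triPoint (Φ a)) = lam)
    (h₁₂ : dist (triPoint η₁) (triPoint η₂) = lam) :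
    ∃ x₁ x₂ : Fin N, y x₁ ∈ ball (y a) r ∧ y x₂ ∈ ball (y a) r ∧ Φ x₁ = η₁ ∧ Φ x₂ = η₂ ∧
      a ≠ x₁ ∧ a ≠ x₂ ∧ x₁ ≠ x₂ ∧ ({a, x₁, x₂} : Finset (Fin N)) ∈ simplicesAt α y lam := by
  classical
  have hl0 : 0 < lam := by linarith
  have haω : y a ∈ ball (y a) r := by rw [mem_ball, dist_self]; linarith
  -- preimages
  obtain ⟨x₁, hx₁ω, hΦ₁⟩ := h62 η₁ (by rw [h₁]; linarith)
  obtain ⟨x₂, hx₂ω, hΦ₂⟩ := h62 η₂ (by rw [h₂]; linarith)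
  -- distinctness
  have hax₁ : a ≠ x₁ := by
    intro h; rw [← h] at hΦ₁; rw [← hΦ₁, dist_self] at h₁; linarith
  have hax₂ : a ≠ x₂ := by
    intro h; rw [← h] at hΦ₂; rw [← hΦ₂, dist_self] at h₂; linarith
  have hx₁₂ : x₁ ≠ x₂ := by
    intro h; rw [h, hΦ₂] at hΦ₁; rw [hΦ₁, dist_self] at h₁₂; linarith
  -- side lengths in y
  have hd : ∀ v w : Fin N, y v ∈ ball (y a) r → y w ∈ ball (y a) r → v ≠ w →
      dist (triPoint (Φ v)) (triPoint (Φ w)) = lam → dist (y v) (y w) ≤ 3 / 2 * lam := by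
    intro v w hv hw hvw hΦvw
    have h := h61 v w hv hw hvw
    rw [hΦvw] at h
    have hpos : 0 < dist (y v) (y w) := by have := hsep v w hvw; linarith
    exact dist_le_of_ratio hpos hKα h
  have d01 : dist (y a) (y x₁) ≤ 3 / 2 * lam :=
    hd a x₁ haω hx₁ω hax₁ (by rw [hΦ₁, dist_comm]; exact h₁)
  have d02 : dist (y a) (y x₂) ≤ 3 / 2 * lam :=
    hd a x₂ haω hx₂ω hax₂ (by rw [hΦ₂, dist_comm]; exact h₂)
  have d12 : dist (y x₁) (y x₂) ≤ 3 / 2 * lam :=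
    hd x₁ x₂ hx₁ω hx₂ω hx₁₂ (by rw [hΦ₁, hΦ₂]; exact h₁₂)
  -- the simplex and its barycentre
  set T : Finset (Fin N) := {a, x₁, x₂} with hT
  have hTcard : T.card = 3 := by
    rw [hT, Finset.card_insert_of_notMem (by simp [hax₁, hax₂]),
      Finset.card_insert_of_notMem (by simp [hx₁₂]), Finset.card_singleton]
  have hz : simplexCentre y T = (3 : ℝ)⁻¹ • (y a + (y x₁ + y x₂)) := by
    rw [simplexCentre, hT, Finset.sum_insert (by simp [hax₁, hax₂]),
      Finset.sum_insert (by simp [hx₁₂]), Finset.sum_singleton]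
  set z := simplexCentre y T with hzdef
  have hcen : ∀ v ∈ T, dist (y v) z ≤ lam := by
    have key : ∀ (u v w : Plane), dist u v ≤ 3 / 2 * lam → dist u w ≤ 3 / 2 * lam →
        dist u ((3 : ℝ)⁻¹ • (u + (v + w))) ≤ lam := by
      intro u v w huv huw
      have e : u - (3 : ℝ)⁻¹ • (u + (v + w)) = (3 : ℝ)⁻¹ • ((u - v) + (u - w)) := by module
      rw [dist_eq_norm, e, norm_smul, Real.norm_eq_abs, abs_of_pos (by norm_num)]
      have := norm_add_le (u - v) (u - w)
      rw [← dist_eq_norm, ← dist_eq_norm] at this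
      nlinarith
    intro v hv
    rw [hz]
    simp only [hT, Finset.mem_insert, Finset.mem_singleton] at hv
    rcases hv with rfl | rfl | rfl
    · exact key _ _ _ d01 d02
    · have e : (3 : ℝ)⁻¹ • (y a + (y v + y x₂)) = (3 : ℝ)⁻¹ • (y v + (y a + y x₂)) := by module
      rw [e]; exact key _ _ _ (by rw [dist_comm]; exact d01) d12
    · have e : (3 : ℝ)⁻¹ • (y a + (y x₁ + y v)) = (3 : ℝ)⁻¹ • (y v + (y a + y x₁)) := by module
      rw [e]
      exact key _ _ _ (by rw [dist_comm]; exact d02) (by rw [dist_comm]; exact d12)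
  have haz : dist (y a) z ≤ lam := hcen a (by simp [hT])
  -- the patch ω_T = y⁻¹(B̄(z, 3λ)) ⊂ ω
  set ωT : Set (Fin N) := y ⁻¹' closedBall z (3 * lam) with hωT
  have hωTω : ωT ⊆ y ⁻¹' ball (y a) r := by
    intro q hq
    show y q ∈ ball (y a) r
    rw [mem_ball]
    have h1 := mem_closedBall.1 hq
    have := dist_triangle (y q) z (y a)
    rw [dist_comm z (y a)] at this
    linarith
  refine ⟨x₁, x₂, hx₁ω, hx₂ω, hΦ₁, hΦ₂, hax₁, hax₂, hx₁₂, mem_simplicesAt.2 ⟨⟨hTcard, Or.inr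
    ⟨hlam, fun b hb => ?_, ωT, Φ, ?_, fun v hv => ?_, hΦ.mono hωTω, fun v hv w hw hvw => ?_,
      ?_, ?_⟩⟩, fun _ => hcen⟩⟩
  · -- defects are far from z
    have h := hfar b hb
    have := dist_triangle (y b) z (y a)
    rw [dist_comm z (y a)] at this
    linarith
  · -- ω_T misses the defects
    rw [Set.disjoint_left]
    intro q hq hqd
    have h := hfar q hqd
    have h1 := mem_closedBall.1 hq
    have := dist_triangle (y q) z (y a)
    rw [dist_comm z (y a)] at this
    linarith
  · -- T ⊂ ω_T
    show y v ∈ closedBall z (3 * lam)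
    rw [mem_closedBall]
    linarith [hcen v hv]
  · -- (23)
    have hvals : ∀ u ∈ T, u = a ∨ u = x₁ ∨ u = x₂ := fun u hu => by
      simpa [hT, Finset.mem_insert, Finset.mem_singleton] using hu
    have ha1 : dist (triPoint (Φ a)) (triPoint (Φ x₁)) = lam := by rw [hΦ₁, dist_comm]; exact h₁
    have ha2 : dist (triPoint (Φ a)) (triPoint (Φ x₂)) = lam := by rw [hΦ₂, dist_comm]; exact h₂
    have h12' : dist (triPoint (Φ x₁)) (triPoint (Φ x₂)) = lam := by rw [hΦ₁, hΦ₂]; exact h₁₂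
    rcases hvals v hv with rfl | rfl | rfl <;> rcases hvals w hw with rfl | rfl | rfl
    all_goals first | exact absurd rfl hvw | skip
    · exact ha1
    · exact ha2
    · rw [dist_comm]; exact ha1
    · exact h12'
    · rw [dist_comm]; exact ha2
    · rw [dist_comm]; exact h12'
  · -- y(ω_T) ⊂ B̄(z, 5λ)
    rintro _ ⟨q, hq, rfl⟩
    rw [mem_closedBall]
    have := mem_closedBall.1 hq
    linarith
  · -- B̄(z, 3λ) ∩ y(X) ⊂ y(ω_T)
    rintro _ ⟨hq, ⟨q, rfl⟩⟩
    exact ⟨q, hq, rfl⟩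


/-! ### Lattice rotations by ±60° and Proposition 2.8 (2): two simplices through a long pair -/

/-- Rotation by `−60°` of `A₂` in lattice coordinates: `(k₁,k₂) ↦ (k₁+k₂, −k₁)` (the `Q₊` of
p. 24). [cite: Theil2006, Appendix proof of Proposition 2.8 (2) (preprint p. 24)] -/
def rot60inv (k : ℤ × ℤ) : ℤ × ℤ := (k.1 + k.2, -k.1)

/-- `|Q k| = |k|`. [folklore] -/
private theorem norm_triPoint_rot60 (k : ℤ × ℤ) : ‖triPoint (rot60 k)‖ = ‖triPoint k‖ := by
  have h : ‖triPoint (rot60 k)‖ ^ 2 = ‖triPoint k‖ ^ 2 := by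
    rw [norm_triPoint_sq, norm_triPoint_sq]
    simp only [rot60]
    push_cast
    ring
  rw [← Real.sqrt_sq (norm_nonneg (triPoint (rot60 k))), h, Real.sqrt_sq (norm_nonneg _)]

/-- `|Q⁻¹ k| = |k|`. [folklore] -/
private theorem norm_triPoint_rot60inv (k : ℤ × ℤ) : ‖triPoint (rot60inv k)‖ = ‖triPoint k‖ := by
  have h : ‖triPoint (rot60inv k)‖ ^ 2 = ‖triPoint k‖ ^ 2 := by
    rw [norm_triPoint_sq, norm_triPoint_sq]
    simp only [rot60inv]
    push_cast
    ring
  rw [← Real.sqrt_sq (norm_nonneg (triPoint (rot60inv k))), h, Real.sqrt_sq (norm_nonneg _)]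

/-- `k − Q k = Q⁻¹ k` (the triangle `0, k, Qk` is equilateral; `Q = Theil2006.rot60` of
`Theil2006DiscreteImbedding.lean`). [folklore] -/
private theorem sub_rot60 (k : ℤ × ℤ) : k - rot60 k = rot60inv k :=
  Prod.ext (by simp only [rot60, rot60inv, Prod.fst_sub]; ring)
    (by simp only [rot60, rot60inv, Prod.snd_sub]; ring)

/-- `k − Q⁻¹ k = Q k`. [folklore] -/
private theorem sub_rot60inv (k : ℤ × ℤ) : k - rot60inv k = rot60 k :=
  Prod.ext (by simp only [rot60, rot60inv, Prod.fst_sub]; ring)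
    (by simp only [rot60, rot60inv, Prod.snd_sub]; ring)

/-- `Q k ≠ Q⁻¹ k` for `k ≠ 0` (rotation by `120°` has no nonzero fixed point). [folklore] -/
private theorem rot60_ne_rot60inv {k : ℤ × ℤ} (hk : k ≠ 0) : rot60 k ≠ rot60inv k := by
  intro h
  simp only [rot60, rot60inv, Prod.mk.injEq] at h
  apply hk
  refine Prod.ext ?_ ?_
  · show k.1 = 0
    omega
  · show k.2 = 0
    omega

/-- **Theil 2006, Proposition 2.8 (2) from Proposition 4.8** (p. 24: "let `η± = Φ(x₁) +
Q±(Φ(x₂) − Φ(x₁))` … Since `A₂` is invariant under `Q±` we obtain that `η± ∈ A₂`. By (62)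
`η± ∈ Φ(y⁻¹(Ω))` hence there are two preimages `x±` … both simplices `T± = {x₁, x₂, x±}` satisfy
(23). Estimate (61) implies … (24)"). For a long pair `{x₁,x₂}` (`|y(x₁)−y(x₂)| = d > 1 + α`)
with a reference configuration `Φ` on `y⁻¹(B(y(x₁), r))`, `r ≥ 5d`, with (61) (`Kα ≤ 1/10`),
(62) at `x₁` for lattice points within `2d`, and no defect within `24d` of `y(x₁)`: with
`λ = |Φ(x₁) − Φ(x₂)|` one has `λ ∈ Λ ∖ {1}` (Remark 2.5) and at least TWO centred simplices of
`𝒯_λ(y)` contain `x₁, x₂`. (Contrapositive = Proposition 2.8 (3).)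
[cite: Theil2006, §2.3 Proposition 2.8 (2), (3) with Appendix proof (p. 24), Proposition 4.8 (61), (62), Remark 2.5 (preprint pp. 7–8, 21, 24)] -/
theorem two_le_card_through_pair_of_reference {K r : ℝ} (hα : 0 < α) (hα1 : α < 1)
    (hKα : K * α ≤ 1 / 10) (hsep : ∀ i j : Fin N, i ≠ j → 1 - α < dist (y i) (y j))
    {x₁ x₂ : Fin N} (hx : x₁ ≠ x₂) (hlong : ¬ IsShortRange α y x₁ x₂)
    (hr : 5 * dist (y x₁) (y x₂) ≤ r) {Φ : Fin N → ℤ × ℤ}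
    (hΦ : IsDiscreteImbeddingOn α y (y ⁻¹' ball (y x₁) r) Φ)
    (h61 : ∀ v w : Fin N, y v ∈ ball (y x₁) r → y w ∈ ball (y x₁) r → v ≠ w →
      |dist (triPoint (Φ v)) (triPoint (Φ w)) / dist (y v) (y w) - 1| ≤ K * α)
    (h62 : ∀ g : ℤ × ℤ, dist (triPoint g) (triPoint (Φ x₁)) < 2 * dist (y x₁) (y x₂) →
      ∃ v : Fin N, y v ∈ ball (y x₁) r ∧ Φ v = g)
    (hfar : ∀ b ∈ defectSet α y, 24 * dist (y x₁) (y x₂) ≤ dist (y b) (y x₁)) :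
    dist (triPoint (Φ x₁)) (triPoint (Φ x₂)) ∈ distSet \ {1} ∧
      2 ≤ ((simplicesAt α y (dist (triPoint (Φ x₁)) (triPoint (Φ x₂)))).filter
        fun T => x₁ ∈ T ∧ x₂ ∈ T).card := by
  classical
  set d := dist (y x₁) (y x₂) with hd
  set lam := dist (triPoint (Φ x₁)) (triPoint (Φ x₂)) with hlam
  set u : ℤ × ℤ := Φ x₂ - Φ x₁ with hu
  -- d > 1 + α
  have hd1 : 1 + α < d := by
    have h1 := hsep x₁ x₂ hx
    by_contra hle
    exact hlong (show |dist (y x₁) (y x₂) - 1| ≤ α from abs_le.2 ⟨by linarith, by linarith⟩)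
  have hd0 : 0 < d := by linarith
  have hx₁ω : y x₁ ∈ ball (y x₁) r := by rw [mem_ball, dist_self]; linarith
  have hx₂ω : y x₂ ∈ ball (y x₁) r := by rw [mem_ball, dist_comm]; linarith
  -- λ and u
  have hu0 : u ≠ 0 := by
    intro h0
    exact hx (hΦ.injOn hx₁ω hx₂ω (sub_eq_zero.1 h0).symm)
  have hlamu : lam = ‖triPoint u‖ := by
    rw [hlam, dist_comm, dist_eq_norm, ← map_sub]
  have hratio := h61 x₁ x₂ hx₁ω hx₂ω hx
  rw [← hlam, ← hd] at hratio
  have hlamd : lam ≤ 11 / 10 * d ∧ 9 / 10 * d ≤ lam := by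
    have h1 := (abs_le.1 hratio).1
    have h2 := (abs_le.1 hratio).2
    rw [div_sub_one (ne_of_gt hd0)] at h1 h2
    rw [le_div_iff₀ hd0] at h1
    rw [div_le_iff₀ hd0] at h2
    constructor <;> nlinarith
  -- λ ≠ 1 by Remark 2.5, hence λ ≥ √3 > 1
  have hx₁def : x₁ ∉ defectSet α y := by
    intro hdef
    have := hfar x₁ hdef
    rw [dist_self] at this
    linarith
  have hlam1 : lam ≠ 1 := by
    intro h1
    apply hlong
    refine hΦ.isShortRange_of_dist_eq_one hα1 hx₁def (fun v hv => ?_) hx₂ω h1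
    show y v ∈ ball (y x₁) r
    rw [mem_ball]
    rcases (mem_nbhdSet_iff).1 hv with rfl | hv'
    · rw [dist_self]; linarith
    · have := hv'.dist_le; rw [dist_comm] at this; linarith
  have hlam3 : √3 ≤ lam := by
    rw [hlamu] at hlam1 ⊢
    exact sqrt_three_le_norm_triPoint_of_ne_one hu0 hlam1
  have h3gt : (1 : ℝ) < √3 := by
    rw [show (1 : ℝ) = √1 by simp]
    exact Real.sqrt_lt_sqrt (by norm_num) (by norm_num)
  have hlam1' : 1 < lam := lt_of_lt_of_le h3gt hlam3
  have hlamΛ : lam ∈ distSet \ {1} := by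
    refine ⟨⟨by linarith, ?_⟩, hlam1⟩
    rw [m_ne_zero_iff]
    exact ⟨u, ⟨hu0, hlamu.symm⟩⟩
  refine ⟨hlamΛ, ?_⟩
  -- the two lattice triangles
  have key : ∀ η : ℤ × ℤ, η = Φ x₁ + rot60 u ∨ η = Φ x₁ + rot60inv u →
      dist (triPoint η) (triPoint (Φ x₁)) = lam ∧ dist (triPoint (Φ x₂)) (triPoint η) = lam := by
    intro η hη
    rcases hη with rfl | rfl
    · constructor
      · rw [dist_eq_norm, ← map_sub, add_sub_cancel_left, norm_triPoint_rot60, ← hlamu]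
      · rw [dist_eq_norm, ← map_sub, show Φ x₂ - (Φ x₁ + rot60 u) = u - rot60 u by
          rw [hu]; abel, sub_rot60, norm_triPoint_rot60inv, ← hlamu]
    · constructor
      · rw [dist_eq_norm, ← map_sub, add_sub_cancel_left, norm_triPoint_rot60inv, ← hlamu]
      · rw [dist_eq_norm, ← map_sub, show Φ x₂ - (Φ x₁ + rot60inv u) = u - rot60inv u by
          rw [hu]; abel, sub_rot60inv, norm_triPoint_rot60, ← hlamu]
  have h2x : dist (triPoint (Φ x₂)) (triPoint (Φ x₁)) = lam := by rw [hlam, dist_comm]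
  -- apply the construction with a = x₁, η₁ = Φ x₂, η₂ = η±
  have build : ∀ η : ℤ × ℤ, η = Φ x₁ + rot60 u ∨ η = Φ x₁ + rot60inv u →
      ∃ x₃ : Fin N, y x₃ ∈ ball (y x₁) r ∧ Φ x₃ = η ∧
        ({x₁, x₂, x₃} : Finset (Fin N)) ∈ (simplicesAt α y lam).filter
          fun T => x₁ ∈ T ∧ x₂ ∈ T := by
    intro η hη
    obtain ⟨hη1, hη2⟩ := key η hη
    obtain ⟨v, x₃, hvω, hx₃ω, hΦv, hΦ₃, -, -, -, hT⟩ :=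
      exists_centredSimplex_of_reference (K := K) hα hα1 (by linarith) hsep x₁ hlam1'
        (show 4 * lam < r by linarith [hlamd.1]) hΦ h61
        (fun g hg => h62 g (by linarith [hlamd.1])) (fun b hb => by
          have := hfar b hb; linarith [hlamd.1]) h2x hη1 hη2
    have hv : v = x₂ := hΦ.injOn hvω hx₂ω hΦv
    subst hv
    exact ⟨x₃, hx₃ω, hΦ₃, Finset.mem_filter.2 ⟨hT, by simp, by simp⟩⟩
  obtain ⟨xp, hxpω, hΦp, hTp⟩ := build _ (Or.inl rfl)
  obtain ⟨xm, hxmω, hΦm, hTm⟩ := build _ (Or.inr rfl)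
  have hpm : xp ≠ xm := by
    intro h
    rw [h, hΦm] at hΦp
    exact rot60_ne_rot60inv hu0 (add_left_cancel hΦp).symm
  have hne : ({x₁, x₂, xp} : Finset (Fin N)) ≠ {x₁, x₂, xm} := by
    intro h
    have hmem : xp ∈ ({x₁, x₂, xm} : Finset (Fin N)) := by rw [← h]; simp
    simp only [Finset.mem_insert, Finset.mem_singleton] at hmem
    rcases hmem with h1 | h2 | h3
    · -- xp = x₁: but Φ xp = Φ x₁ + rot60 u ≠ Φ x₁
      rw [h1] at hΦp
      have : rot60 u = 0 := by
        have := hΦp; rw [eq_comm, add_eq_left] at this; exact this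
      apply hu0
      have h' := norm_triPoint_rot60 u
      rw [this, map_zero, norm_zero] at h'
      have : ‖triPoint u‖ = 0 := h'.symm
      rw [norm_eq_zero] at this
      exact triPoint_injective (by rw [this, map_zero])
    · rw [h2] at hΦp
      have : rot60 u = u := by
        have := hΦp; rw [hu] at this ⊢
        have e := congrArg (fun w => w - Φ x₁) this
        simp at e
        rw [← hu] at e ⊢; exact e.symm
      -- rot60 u = u forces u = 0
      apply hu0
      simp only [rot60, Prod.ext_iff] at this
      ext
      · simp; omega
      · simp; omega
    · exact hpm h3
  calc 2 = ({({x₁, x₂, xp} : Finset (Fin N)), {x₁, x₂, xm}} : Finset (Finset (Fin N))).card := by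
        rw [Finset.card_pair hne]
    _ ≤ _ := Finset.card_le_card fun T hT => by
        simp only [Finset.mem_insert, Finset.mem_singleton] at hT
        rcases hT with rfl | rfl
        · exact hTp
        · exact hTm


/-! ### (70) converse off the defects: `s(x, λ) ≥ 6 m(λ)` from (62) -/

/-- `Q(Q k) ≠ k` for `k ≠ 0` (rotation by `120°`). [folklore] -/
private theorem rot60_rot60_ne_self {k : ℤ × ℤ} (hk : k ≠ 0) : rot60 (rot60 k) ≠ k := by
  intro h
  simp only [rot60, Prod.ext_iff] at h
  apply hk
  refine Prod.ext ?_ ?_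
  · show k.1 = 0
    omega
  · show k.2 = 0
    omega

/-- `Q` is injective. [folklore] -/
private theorem rot60_injective : Function.Injective rot60 := by
  intro a b h
  simp only [rot60, Prod.mk.injEq, neg_inj] at h
  obtain ⟨h1, h2⟩ := h
  refine Prod.ext ?_ h1
  show a.1 = b.1
  omega

/-- `Q k = 0` only for `k = 0`. [folklore] -/
private theorem eq_zero_of_rot60_eq_zero {k : ℤ × ℤ} (h : rot60 k = 0) : k = 0 := by
  simp only [rot60, Prod.ext_iff] at h
  obtain ⟨h1, h2⟩ := h
  refine Prod.ext ?_ ?_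
  · show k.1 = 0
    simp at h1 h2; omega
  · show k.2 = 0
    simp at h1; omega

/-- **Theil 2006, `s(x, λ) ≥ 6m(λ)` off the defects, from Proposition 4.8** (p. 24: "In
particular … together with formula (21)", and the contrapositive form "for each `x` with
`s(x,λ) < 6m(λ)` there exists `x_b ∈ ∂X` such that `y(x_b) ∈ B(y(x), 28λ)`"): with a reference
configuration `Φ` on `y⁻¹(B(y(x), r))`, `r > 4λ`, satisfying (61) (`Kα ≤ 1/3`) and (62) at `x`
(lattice points within `3λ/2`), and no defect within `21λ` of `y(x)`, every shell vector
`u`, `|u| = λ`, yields the centred simplex `{x, Φ⁻¹(Φx+u), Φ⁻¹(Φx+Qu)} ∈ 𝒯_λ(y)`, injectively in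
`u`; there are `6m(λ)` shell vectors (21).
[cite: Theil2006, Appendix proof of Proposition 2.9 ((70) "other direction") with (21), Proposition 4.8 (61), (62) (preprint pp. 8, 21, 24)] -/
theorem six_m_le_cornerCount_of_reference {K lam r : ℝ} (hα : 0 < α) (hα1 : α < 1)
    (hKα : K * α ≤ 1 / 3) (hsep : ∀ i j : Fin N, i ≠ j → 1 - α < dist (y i) (y j))
    (x : Fin N) (hlam : 1 < lam) (hr : 4 * lam < r) {Φ : Fin N → ℤ × ℤ}
    (hΦ : IsDiscreteImbeddingOn α y (y ⁻¹' ball (y x) r) Φ)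
    (h61 : ∀ v w : Fin N, y v ∈ ball (y x) r → y w ∈ ball (y x) r → v ≠ w →
      |dist (triPoint (Φ v)) (triPoint (Φ w)) / dist (y v) (y w) - 1| ≤ K * α)
    (h62 : ∀ g : ℤ × ℤ, dist (triPoint g) (triPoint (Φ x)) < 3 / 2 * lam →
      ∃ v : Fin N, y v ∈ ball (y x) r ∧ Φ v = g)
    (hfar : ∀ b ∈ defectSet α y, 21 * lam < dist (y b) (y x)) :
    6 * m lam ≤ cornerCount α y lam x := by
  classical
  set S := (shell_finite lam).toFinset with hS
  have hSc : S.card = 6 * m lam := by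
    rw [six_mul_m, Nat.card_coe_set_eq, Set.ncard_eq_toFinset_card _ (shell_finite lam)]
  -- the lattice triangle of a shell vector
  have tri : ∀ u ∈ S,
      dist (triPoint (Φ x + u)) (triPoint (Φ x)) = lam ∧
      dist (triPoint (Φ x + rot60 u)) (triPoint (Φ x)) = lam ∧
      dist (triPoint (Φ x + u)) (triPoint (Φ x + rot60 u)) = lam := by
    intro u hu
    have hu' : u ∈ shell lam := (Set.Finite.mem_toFinset _).1 hu
    refine ⟨?_, ?_, ?_⟩
    · rw [dist_eq_norm, ← map_sub, add_sub_cancel_left]; exact hu'.2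
    · rw [dist_eq_norm, ← map_sub, add_sub_cancel_left, norm_triPoint_rot60]; exact hu'.2
    · rw [dist_eq_norm, ← map_sub, add_sub_add_left_eq_sub, sub_rot60, norm_triPoint_rot60inv]
      exact hu'.2
  have build : ∀ u ∈ S, ∃ T : Finset (Fin N), T ∈ (simplicesAt α y lam).filter (fun T => x ∈ T) ∧
      ∃ x₁ x₂ : Fin N, T = {x, x₁, x₂} ∧ y x₁ ∈ ball (y x) r ∧ y x₂ ∈ ball (y x) r ∧
        Φ x₁ = Φ x + u ∧ Φ x₂ = Φ x + rot60 u := by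
    intro u hu
    obtain ⟨h1, h2, h12⟩ := tri u hu
    obtain ⟨x₁, x₂, hx₁ω, hx₂ω, hΦ₁, hΦ₂, -, -, -, hT⟩ :=
      exists_centredSimplex_of_reference hα hα1 hKα hsep x hlam hr hΦ h61 h62 hfar h1 h2 h12
    exact ⟨{x, x₁, x₂}, Finset.mem_filter.2 ⟨hT, by simp⟩, x₁, x₂, rfl, hx₁ω, hx₂ω, hΦ₁, hΦ₂⟩
  choose! F hF using build
  have hinj : Set.InjOn F ↑S := by
    intro u hu u' hu' hFF
    have hu := Finset.mem_coe.1 hu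
    have hu' := Finset.mem_coe.1 hu'
    obtain ⟨-, x₁, x₂, hT, hx₁ω, hx₂ω, hΦ₁, hΦ₂⟩ := hF u hu
    obtain ⟨-, x₁', x₂', hT', hx₁ω', hx₂ω', hΦ₁', hΦ₂'⟩ := hF u' hu'
    have hu0 : u ≠ 0 := ((Set.Finite.mem_toFinset _).1 hu).1
    have hu0' : u' ≠ 0 := ((Set.Finite.mem_toFinset _).1 hu').1
    have hxω : y x ∈ ball (y x) r := by rw [mem_ball, dist_self]; linarith
    -- x₁ ∈ F u = F u' = {x, x₁', x₂'}
    have hmem : x₁ ∈ ({x, x₁', x₂'} : Finset (Fin N)) := by rw [← hT', ← hFF, hT]; simp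
    simp only [Finset.mem_insert, Finset.mem_singleton] at hmem
    rcases hmem with h | h | h
    · -- x₁ = x : Φ x + u = Φ x
      rw [h] at hΦ₁
      exact absurd (add_eq_left.1 hΦ₁.symm) hu0
    · -- x₁ = x₁' : u = u'
      rw [h, hΦ₁'] at hΦ₁
      exact (add_left_cancel hΦ₁).symm
    · -- x₁ = x₂' : u = rot60 u'; then look at x₂
      rw [h, hΦ₂'] at hΦ₁
      have hu_eq : u = rot60 u' := (add_left_cancel hΦ₁).symm
      have hmem2 : x₂ ∈ ({x, x₁', x₂'} : Finset (Fin N)) := by rw [← hT', ← hFF, hT]; simp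
      simp only [Finset.mem_insert, Finset.mem_singleton] at hmem2
      rcases hmem2 with h2 | h2 | h2
      · rw [h2] at hΦ₂
        have : rot60 u = 0 := add_eq_left.1 hΦ₂.symm
        exact absurd (eq_zero_of_rot60_eq_zero this) hu0
      · rw [h2, hΦ₁'] at hΦ₂
        have : u' = rot60 u := add_left_cancel hΦ₂
        rw [hu_eq] at this
        exact absurd this.symm (rot60_rot60_ne_self hu0')
      · rw [h2, hΦ₂'] at hΦ₂
        have : rot60 u' = rot60 u := add_left_cancel hΦ₂
        exact (rot60_injective this).symm ▸ rfl
  calc 6 * m lam = S.card := hSc.symm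
    _ = (S.image F).card := (Finset.card_image_of_injOn hinj).symm
    _ ≤ cornerCount α y lam x := by
        unfold cornerCount
        exact Finset.card_le_card fun T hT => by
          obtain ⟨u, hu, rfl⟩ := Finset.mem_image.1 hT
          exact (hF u hu).1


/-! ### Two bookkeeping lemmas for assembling the Proposition-4.8 hypotheses -/

/-- For a finite configuration a closed ball of particles is an open ball of particles of a
slightly larger radius. [cite: Theil2006, Appendix proof of Proposition 2.9 (70) (preprint p. 24); our lemma] -/
theorem preimage_closedBall_eq_ball (y : Fin N → Plane) (c : Plane) (ρ : ℝ) :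
    ∃ ρ' : ℝ, ρ < ρ' ∧ ρ' ≤ ρ + 1 ∧ y ⁻¹' closedBall c ρ = y ⁻¹' ball c ρ' := by
  classical
  set S := Finset.univ.filter fun q : Fin N => ρ < dist (y q) c with hS
  by_cases hSe : S = ∅
  · refine ⟨ρ + 1, by linarith, le_rfl, Set.ext fun q => ?_⟩
    simp only [Set.mem_preimage, mem_closedBall, mem_ball]
    constructor
    · intro h; linarith
    · intro h
      by_contra hgt
      have : q ∈ S := Finset.mem_filter.2 ⟨Finset.mem_univ _, not_le.1 hgt⟩
      rw [hSe] at this; exact absurd this (Finset.notMem_empty _)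
  · have hne : S.Nonempty := Finset.nonempty_iff_ne_empty.2 hSe
    set δ := S.inf' hne fun q => dist (y q) c with hδ
    have hδρ : ρ < δ := by
      obtain ⟨q, hq, hqδ⟩ := Finset.exists_mem_eq_inf' hne fun q => dist (y q) c
      rw [hδ, hqδ]; exact (Finset.mem_filter.1 hq).2
    refine ⟨min δ (ρ + 1), lt_min hδρ (by linarith), min_le_right _ _, Set.ext fun q => ?_⟩
    simp only [Set.mem_preimage, mem_closedBall, mem_ball]
    constructor
    · intro h; exact lt_min (lt_of_le_of_lt h hδρ) (by linarith)
    · intro h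
      by_contra hgt
      have hqS : q ∈ S := Finset.mem_filter.2 ⟨Finset.mem_univ _, not_le.1 hgt⟩
      have hle : δ ≤ dist (y q) c := Finset.inf'_le _ hqS
      have := lt_of_lt_of_le h (min_le_left _ _)
      linarith

/-- **The side parameter of a centred simplex through `{x₁,x₂}` is read off any reference
configuration around the midpoint** (p. 23, the step "`λ₁ = λ₂`"): if `T ∈ 𝒯_λ(y)` is centred,
contains `x₁ ≠ x₂`, and `Φ` is a reference configuration with (60) on `y⁻¹(B(m, d/2 + 1))`
(`m` the midpoint, `d = |y(x₁) − y(x₂)|`), then `|Φ(x₁) − Φ(x₂)| = λ`.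
[cite: Theil2006, Appendix proof of Proposition 2.8 (1) with Proposition 4.8 (60) (preprint pp. 21, 23)] -/
theorem side_eq_dist_reference {lam : ℝ} (hα1 : α < 1)
    (hsep : ∀ i j : Fin N, i ≠ j → 1 - α < dist (y i) (y j)) {x₁ x₂ : Fin N} (hx : x₁ ≠ x₂)
    {T : Finset (Fin N)} (hT : IsCentredSimplex α y lam T) (hlam : 1 < lam) (hx₁ : x₁ ∈ T)
    (hx₂ : x₂ ∈ T) {Φ : Fin N → ℤ × ℤ}
    (h60 : ∀ Φ' : Fin N → ℤ × ℤ,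
      IsDiscreteImbeddingOn α y
        (y ⁻¹' ball ((2 : ℝ)⁻¹ • (y x₁ + y x₂)) (dist (y x₁) (y x₂) / 2 + 1)) Φ' →
      ∃ Rot : Plane ≃ₗᵢ[ℝ] Plane, ∀ a b : Fin N,
        y a ∈ ball ((2 : ℝ)⁻¹ • (y x₁ + y x₂)) (dist (y x₁) (y x₂) / 2 + 1) →
        y b ∈ ball ((2 : ℝ)⁻¹ • (y x₁ + y x₂)) (dist (y x₁) (y x₂) / 2 + 1) →
        triPoint (Φ' a) - triPoint (Φ' b) = Rot (triPoint (Φ a) - triPoint (Φ b))) :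
    dist (triPoint (Φ x₁)) (triPoint (Φ x₂)) = lam := by
  set m : Plane := (2 : ℝ)⁻¹ • (y x₁ + y x₂) with hm
  set d := dist (y x₁) (y x₂) with hd
  set ω : Set (Fin N) := y ⁻¹' ball m (d / 2 + 1) with hω
  have hyinj : Function.Injective y := by
    intro i j hij
    by_contra hne
    have := hsep i j hne
    rw [hij, dist_self] at this
    linarith
  obtain ⟨hT26, hcen⟩ := hT
  have hcen' := hcen hlam
  set z := simplexCentre y T with hz
  -- midpoint geometry
  have hm1 : dist (y x₁) m = d / 2 := by
    have e : y x₁ - m = (2 : ℝ)⁻¹ • (y x₁ - y x₂) := by rw [hm]; module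
    rw [dist_eq_norm, e, norm_smul, Real.norm_eq_abs, abs_of_pos (by norm_num), ← dist_eq_norm, hd]
    ring
  have hm2 : dist (y x₂) m = d / 2 := by
    have e : y x₂ - m = (2 : ℝ)⁻¹ • (y x₂ - y x₁) := by rw [hm]; module
    rw [dist_eq_norm, e, norm_smul, Real.norm_eq_abs, abs_of_pos (by norm_num), ← dist_eq_norm,
      dist_comm, hd]
    ring
  have hzm : dist z m ≤ lam := by
    have e : z - m = (2 : ℝ)⁻¹ • ((z - y x₁) + (z - y x₂)) := by rw [hm]; module
    rw [dist_eq_norm, e, norm_smul, Real.norm_eq_abs, abs_of_pos (by norm_num)]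
    have h := norm_add_le (z - y x₁) (z - y x₂)
    rw [← dist_eq_norm, ← dist_eq_norm, dist_comm z (y x₁), dist_comm z (y x₂)] at h
    have h1 := hcen' x₁ hx₁
    have h2 := hcen' x₂ hx₂
    linarith
  have hd2 : d ≤ 2 * lam := by
    have := dist_triangle (y x₁) z (y x₂)
    rw [dist_comm z (y x₂)] at this
    linarith [hcen' x₁ hx₁, hcen' x₂ hx₂]
  have hx₁ω : y x₁ ∈ ball m (d / 2 + 1) := by rw [mem_ball, hm1]; linarith
  have hx₂ω : y x₂ ∈ ball m (d / 2 + 1) := by rw [mem_ball, hm2]; linarith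
  rcases hT26.2 with h1 | ⟨-, -, ωT, ΦT, -, hTωT, hΦT, h23, -, h24⟩
  · exact absurd h1.1 (ne_of_gt hlam)
  have hωT : ω ⊆ ωT := by
    intro q hq
    have hq' : y q ∈ closedBall z (3 * lam) ∩ Set.range y := by
      refine ⟨?_, Set.mem_range_self q⟩
      rw [mem_closedBall]
      have h1 := mem_ball.1 hq
      have := dist_triangle (y q) m z
      rw [dist_comm m z] at this
      linarith
    obtain ⟨q', hq'ω, hyq⟩ := h24 hq'
    rwa [← hyinj hyq]
  obtain ⟨Rot, hRot⟩ := h60 ΦT (hΦT.mono hωT)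
  have h := hRot x₁ x₂ hx₁ω hx₂ω
  have h23' := h23 x₁ hx₁ x₂ hx₂ hx
  rw [dist_eq_norm] at h23' ⊢
  rw [h, LinearIsometryEquiv.norm_map] at h23'
  exact h23'

end Theil2006

end Literature.MathematicalPhysics.StatisticalMechanics
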